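import Literature.Geometry.Riemannian.PinchingEstimatesKyFanMinimiser
import Literature.Geometry.Riemannian.PinchingEstimatesConstraints
import Literature.Geometry.Riemannian.PinchingSetsConvexity
import Mathlib.Analysis.Calculus.Deriv.MeanValue
import HarnessLib

/-!
# `a₁ + a₂ ≥ m` is preserved: Hamilton 1997, Thm. B1.2 at the ODE level, and for the Ricci flow modulo the maximum principle
(topic `Geometry/Riemannian`)

**Hamilton 1997, §2.1 (= Section B), Thm. 1.2**, Comm. Anal. Geom. 5, p. 7: "The Ricci flow on
a compact 4-manifold preserves positive isotropic curvature. For any constant `m > 0` the Ricci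
flow preserves the inequalities `a₁ + a₂ ≥ m` and `c₁ + c₂ ≥ m`. Proof. From the ordinary
differential inequalities in [3] `d/dt (a₁ + a₂) ≥ a₁² + a₂² + 2(a₁ + a₂)a₃ + b₁² + b₂²`. Now if
`a₁ + a₂ ≥ m > 0` then `a₃ > 0` also. The set `a₁ + a₂ ≥ m` is convex since `a₁ + a₂` is a
concave function of the matrix `A`. This proves the theorem for `A`, and `C` is the same."
The second sentence is the named fact
`Literature.Geometry.Riemannian.ricciFlow_preserves_twoSmallestEigenvaluesSum_ge`
(`PinchingEstimates.lean`). This file proves everything in the printed proof and leaves exactly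
"[3]" (Hamilton 1986, the maximum principle for systems applied to the curvature of the Ricci
flow: the named fact `hamilton_maximumPrinciple_curvatureODE` of `HamiltonCurvatureODE.lean`)
as the hypothesis of the final reduction:

* `HamiltonODE.twoSmallestEigenvaluesSumGE_of_hasDerivWithinAt` — **the ODE half**: along a
  solution of `A' = A² + B ᵗB + 2A^#` with `A` symmetric, `Matrix.TwoSmallestEigenvaluesSumGE
  (A t) m` (`a₁ + a₂ ≥ m` in Ky Fan form, `PinchingEstimatesODE.lean`), `m > 0`, persists. Proof:
  if not, let `T` be the infimum of the bad times; by compactness of the set of orthonormal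
  pairs and continuity there is a pair `(u, v)` minimising `uᵀA(T)u + vᵀA(T)v` with value `m`,
  where Hamilton's differential inequality (`HamiltonODE.fieldA_quadratic_ge`,
  `PinchingEstimatesKyFanMinimiser.lean`) gives `d/dt (uᵀAu + vᵀAv) ≥ m² > 0`; by continuity
  the derivative stays positive nearby, so `uᵀAu + vᵀAv` is non-decreasing just after `T` for
  all nearby pairs — contradicting the choice of `T`.
* `HamiltonODE.isInvariantRel_twoSmallestEigenvaluesSumGE` — Thm. 1.2 in the logical form of the
  tree's chain of pinching estimates: relative to the (invariant, `isInvariant_isSymm`) constraint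
  `{A, C symmetric}` the set `{a₁ + a₂ ≥ m, c₁ + c₂ ≥ m}` is forward invariant under
  `HamiltonODE.field` (the `C`-equation is the `A`-equation for `(C, ᵗB)`); and
  `HamiltonODE.isInvariant_isSymm_twoSmallestEigenvaluesSumGE`, the invariance of the
  intersection. (Symmetry cannot be dropped: on non-symmetric triples the set is not invariant,
  cf. `PinchingEstimatesConstraints.lean`.)
* `ricciFlow_preserves_twoSmallestEigenvaluesSum_ge_of_maximumPrinciple` — **the named fact
  follows from `hamilton_maximumPrinciple_curvatureODE`**: the intersection is closed
  (`isClosed_isSymm`, `isClosed_twoSmallestA/C`), convex (`isSymm_combo`,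
  `Matrix.TwoSmallestEigenvaluesSumGE.combo`; Hamilton: "`a₁ + a₂` is a concave function of `A`"),
  independent of `B`, invariant, and contains the blocks of `g(0)` (symmetric by
  `blockA_isSymm`, `blockC_isSymm`).

No definitions are introduced.

## References

* R. S. Hamilton, *Four-manifolds with positive isotropic curvature*, Comm. Anal. Geom. 5 (1997)
  1–92, §2.1, Thm. 1.2 and its proof (p. 7). [Hamilton1997]
* R. S. Hamilton, *Four-manifolds with positive curvature operator*, J. Differential Geom. 24
  (1986) 153–179, §4, Thm. 4.3 (p. 162) and §6 (p. 166). [Hamilton1986]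
-/

noncomputable section

open Set Matrix
open scoped Matrix Topology Manifold ContDiff

namespace Literature.Geometry.Riemannian

namespace HamiltonODE

/-! ### Tools: derivative of a matrix coefficient, compactness of orthonormal pairs -/

/-- The derivative of a matrix coefficient `uᵀ A(s) w` of a differentiable matrix curve.
[folklore] -/
theorem hasDerivWithinAt_quadratic {A : ℝ → Matrix (Fin 3) (Fin 3) ℝ}
    {A' : Matrix (Fin 3) (Fin 3) ℝ} {S : Set ℝ} {s : ℝ}
    (h : ∀ i j, HasDerivWithinAt (fun s ↦ A s i j) (A' i j) S s) (u w : Fin 3 → ℝ) :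
    HasDerivWithinAt (fun s ↦ u ⬝ᵥ (A s *ᵥ w)) (u ⬝ᵥ (A' *ᵥ w)) S s := by
  have h1 : ∀ i, HasDerivWithinAt (fun s ↦ ∑ j, A s i j * w j) (∑ j, A' i j * w j) S s :=
    fun i ↦ HasDerivWithinAt.fun_sum fun j _ ↦ (h i j).mul_const (w j)
  exact HasDerivWithinAt.fun_sum (u := Finset.univ) fun i _ ↦ (h1 i).const_mul (u i)

/-- The set of orthonormal pairs of `ℝ³` is closed. [folklore] -/
theorem isClosed_orthonormalPairs :
    IsClosed {α : (Fin 3 → ℝ) × (Fin 3 → ℝ) |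
      α.1 ⬝ᵥ α.1 = 1 ∧ α.2 ⬝ᵥ α.2 = 1 ∧ α.1 ⬝ᵥ α.2 = 0} := by
  simp only [Set.setOf_and]
  refine (isClosed_eq ?_ continuous_const).inter
    ((isClosed_eq ?_ continuous_const).inter (isClosed_eq ?_ continuous_const)) <;> fun_prop

/-- A unit vector of `ℝ³` has sup norm `≤ 1`. [folklore] -/
theorem norm_le_one_of_dotProduct_self {u : Fin 3 → ℝ} (hu : u ⬝ᵥ u = 1) : ‖u‖ ≤ 1 := by
  rw [pi_norm_le_iff_of_nonneg zero_le_one]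
  intro i
  have h1 : u i * u i ≤ u ⬝ᵥ u :=
    Finset.single_le_sum (f := fun j ↦ u j * u j) (fun j _ ↦ mul_self_nonneg (u j))
      (Finset.mem_univ i)
  rw [hu] at h1
  rw [Real.norm_eq_abs]
  exact abs_le_one_iff_mul_self_le_one.2 h1

/-- **The set of orthonormal pairs of `ℝ³` is compact** (closed and bounded). [folklore] -/
theorem isCompact_orthonormalPairs :
    IsCompact {α : (Fin 3 → ℝ) × (Fin 3 → ℝ) |
      α.1 ⬝ᵥ α.1 = 1 ∧ α.2 ⬝ᵥ α.2 = 1 ∧ α.1 ⬝ᵥ α.2 = 0} := by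
  refine (isCompact_closedBall (0 : (Fin 3 → ℝ) × (Fin 3 → ℝ)) 1).of_isClosed_subset
    isClosed_orthonormalPairs ?_
  rintro ⟨u, v⟩ ⟨hu, hv, -⟩
  rw [Metric.mem_closedBall, dist_zero_right, Prod.norm_def, max_le_iff]
  exact ⟨norm_le_one_of_dotProduct_self hu, norm_le_one_of_dotProduct_self hv⟩

/-! ### The ODE half of Hamilton's Thm. B1.2 -/

/-- **`a₁ + a₂ ≥ m` is preserved by `A' = A² + B ᵗB + 2A^#`** (Hamilton 1997, §2.1, Thm. 1.2 and
its proof, p. 7: "`d/dt (a₁ + a₂) ≥ a₁² + a₂² + 2(a₁ + a₂)a₃ + b₁² + b₂²`. Now if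
`a₁ + a₂ ≥ m > 0` then `a₃ > 0` also"), for continuous curves `A, B` of `3 × 3` matrices with `A`
symmetric and differentiable on `[t₀, t₁]` with the stated derivative, in the Ky Fan form
`Matrix.TwoSmallestEigenvaluesSumGE`. The minimum of `uᵀAu + vᵀAv` over the compact set of
orthonormal pairs cannot reach a first bad time: at a minimiser with value `m` Hamilton's
inequality (`fieldA_quadratic_ge`) makes the derivative `≥ m² > 0`, uniformly nearby by
continuity. [cite: Hamilton1997, §2.1, Thm. 1.2 (proof, p. 7)] -/
theorem twoSmallestEigenvaluesSumGE_of_hasDerivWithinAt {A B : ℝ → Matrix (Fin 3) (Fin 3) ℝ}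
    {t₀ t₁ m : ℝ} (hAc : Continuous A) (hBc : Continuous B) (hm : 0 < m)
    (hA : ∀ s ∈ Icc t₀ t₁, ∀ i j, HasDerivWithinAt (fun s ↦ A s i j)
      ((A s * A s + B s * (B s)ᵀ + (2 : ℝ) • (A s).sharp) i j) (Icc t₀ t₁) s)
    (hsymm : ∀ s ∈ Icc t₀ t₁, (A s).IsSymm) (h0 : (A t₀).TwoSmallestEigenvaluesSumGE m) :
    ∀ s ∈ Icc t₀ t₁, (A s).TwoSmallestEigenvaluesSumGE m := by
  -- the quadratic functional, the field and the derivative functional, jointly continuous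
  set Φ : ((Fin 3 → ℝ) × (Fin 3 → ℝ)) × ℝ → ℝ :=
    fun q ↦ q.1.1 ⬝ᵥ (A q.2 *ᵥ q.1.1) + q.1.2 ⬝ᵥ (A q.2 *ᵥ q.1.2) with hΦ
  set F : ℝ → Matrix (Fin 3) (Fin 3) ℝ :=
    fun s ↦ A s * A s + B s * (B s)ᵀ + (2 : ℝ) • (A s).sharp with hF
  set Ψ : ((Fin 3 → ℝ) × (Fin 3 → ℝ)) × ℝ → ℝ :=
    fun q ↦ q.1.1 ⬝ᵥ (F q.2 *ᵥ q.1.1) + q.1.2 ⬝ᵥ (F q.2 *ᵥ q.1.2) with hΨ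
  have hΦc : Continuous Φ := by rw [hΦ]; fun_prop
  have hFc : Continuous F := by
    rw [hF]
    simp only [Matrix.sharp]
    fun_prop
  have hΨc : Continuous Ψ := by rw [hΨ]; fun_prop
  -- suppose the inequality fails at some time `s₁` for some orthonormal pair
  intro s₁ hs₁ u₁ v₁ hu₁ hv₁ huv₁
  by_contra hlt₁
  push Not at hlt₁
  set Sbad : Set ℝ := {s | s ∈ Icc t₀ t₁ ∧ ∃ α ∈ {α : (Fin 3 → ℝ) × (Fin 3 → ℝ) |
      α.1 ⬝ᵥ α.1 = 1 ∧ α.2 ⬝ᵥ α.2 = 1 ∧ α.1 ⬝ᵥ α.2 = 0}, Φ (α, s) < m} with hSbad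
  have hs₁S : s₁ ∈ Sbad := ⟨hs₁, (u₁, v₁), ⟨hu₁, hv₁, huv₁⟩, hlt₁⟩
  have hne : Sbad.Nonempty := ⟨s₁, hs₁S⟩
  have hbdd : BddBelow Sbad := ⟨t₀, fun s hs ↦ hs.1.1⟩
  -- the first bad time
  set T := sInf Sbad with hT
  have hT₀ : t₀ ≤ T := le_csInf hne fun s hs ↦ hs.1.1
  have hT₁ : T ≤ t₁ := (csInf_le hbdd hs₁S).trans hs₁.2
  have hTmem : T ∈ Icc t₀ t₁ := ⟨hT₀, hT₁⟩
  have hbefore : ∀ s ∈ Icc t₀ t₁, s < T → ∀ α ∈ {α : (Fin 3 → ℝ) × (Fin 3 → ℝ) |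
      α.1 ⬝ᵥ α.1 = 1 ∧ α.2 ⬝ᵥ α.2 = 1 ∧ α.1 ⬝ᵥ α.2 = 0}, m ≤ Φ (α, s) := by
    intro s hs hsT α hα
    by_contra h
    push Not at h
    exact absurd hsT (not_lt.2 (csInf_le hbdd ⟨hs, α, hα, h⟩))
  have hatT : ∀ α ∈ {α : (Fin 3 → ℝ) × (Fin 3 → ℝ) |
      α.1 ⬝ᵥ α.1 = 1 ∧ α.2 ⬝ᵥ α.2 = 1 ∧ α.1 ⬝ᵥ α.2 = 0}, m ≤ Φ (α, T) := by
    intro α hα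
    rcases eq_or_lt_of_le hT₀ with h | h
    · rw [← h]; exact h0 α.1 α.2 hα.1 hα.2.1 hα.2.2
    · have hcont : ContinuousAt (fun s ↦ Φ (α, s)) T := by fun_prop
      have htend : Filter.Tendsto (fun s ↦ Φ (α, s)) (𝓝[<] T) (𝓝 (Φ (α, T))) :=
        hcont.tendsto.mono_left nhdsWithin_le_nhds
      refine ge_of_tendsto htend ?_
      filter_upwards [Ioo_mem_nhdsLT h] with s hs
      exact hbefore s ⟨hs.1.le, hs.2.le.trans hT₁⟩ hs.2 α hα
  -- bad times decreasing to `T`, bad pairs, and a convergent subsequence of pairs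
  obtain ⟨sq, -, hsqT, hsqS⟩ := exists_seq_tendsto_sInf hne hbdd
  choose α hαP hαlt using fun n ↦ (hsqS n).2
  obtain ⟨αs, hαs, κ, hκ, hconv⟩ := isCompact_orthonormalPairs.tendsto_subseq hαP
  have hsqT' : Filter.Tendsto (fun n ↦ sq (κ n)) Filter.atTop (𝓝 T) :=
    hsqT.comp hκ.tendsto_atTop
  have hlim : Filter.Tendsto (fun n ↦ Φ (α (κ n), sq (κ n))) Filter.atTop (𝓝 (Φ (αs, T))) :=
    (hΦc.tendsto _).comp (hconv.prodMk_nhds hsqT')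
  have hle : Φ (αs, T) ≤ m := le_of_tendsto' hlim fun n ↦ (hαlt (κ n)).le
  -- `(αs, T)` minimises with value `m > 0`: Hamilton's inequality gives `Ψ (αs, T) ≥ m² > 0`
  have heq : αs.1 ⬝ᵥ (A T *ᵥ αs.1) + αs.2 ⬝ᵥ (A T *ᵥ αs.2) = m := le_antisymm hle (hatT αs hαs)
  have hΨpos : 0 < Ψ (αs, T) := by
    have key := fieldA_quadratic_ge (B := B T) (hsymm T hTmem) hαs.1 hαs.2.1 hαs.2.2
      (by rw [heq]; exact hm.le)
      (fun u' v' hu' hv' huv' ↦ by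
        have h1 : m ≤ Φ ((u', v'), T) := hatT (u', v') ⟨hu', hv', huv'⟩
        have h2 : Φ ((u', v'), T) = u' ⬝ᵥ (A T *ᵥ u') + v' ⬝ᵥ (A T *ᵥ v') := rfl
        linarith)
    rw [heq] at key
    exact (pow_pos hm 2).trans_le key
  -- hence `Ψ > 0` near `(αs, T)`
  obtain ⟨ε, hε, hball⟩ : ∃ ε > 0, ∀ q, dist q (αs, T) < ε → 0 < Ψ q := by
    obtain ⟨ε, hε, hsub⟩ := Metric.isOpen_iff.1 (isOpen_Ioi.preimage hΨc) (αs, T) hΨpos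
    exact ⟨ε, hε, fun q hq ↦ hsub hq⟩
  have hev1 : ∀ᶠ n in Filter.atTop, dist (α (κ n)) αs < ε := Metric.tendsto_nhds.1 hconv ε hε
  have hev2 : ∀ᶠ n in Filter.atTop, dist (sq (κ n)) T < ε := Metric.tendsto_nhds.1 hsqT' ε hε
  obtain ⟨n, hn1, hn2⟩ := (hev1.and hev2).exists
  have hs₂S : sq (κ n) ∈ Sbad := hsqS (κ n)
  have hs₂ : sq (κ n) ∈ Icc t₀ t₁ := hs₂S.1
  have hTs₂ : T ≤ sq (κ n) := csInf_le hbdd hs₂S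
  have hs₂T : sq (κ n) - T < ε := by
    rw [Real.dist_eq] at hn2
    exact (abs_lt.1 hn2).2
  -- so `Φ (α (κ n), ·)` is non-decreasing on `[T, sq (κ n)]`, contradicting the badness of `sq (κ n)`
  have hmono : MonotoneOn (fun s ↦ Φ (α (κ n), s)) (Icc T (sq (κ n))) := by
    refine monotoneOn_of_hasDerivWithinAt_nonneg (f' := fun s ↦ Ψ (α (κ n), s)) (convex_Icc _ _)
      (by fun_prop : Continuous fun s ↦ Φ (α (κ n), s)).continuousOn ?_ ?_
    · intro x hx
      rw [interior_Icc] at hx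
      have hxI : x ∈ Ioo t₀ t₁ := ⟨hT₀.trans_lt hx.1, hx.2.trans_le hs₂.2⟩
      have hd : ∀ i j, _root_.HasDerivAt (fun s ↦ A s i j) (F x i j) x :=
        fun i j ↦ (hA x ⟨hxI.1.le, hxI.2.le⟩ i j).hasDerivAt (Icc_mem_nhds hxI.1 hxI.2)
      have h1 := hasDerivWithinAt_quadratic (S := interior (Icc T (sq (κ n))))
        (fun i j ↦ (hd i j).hasDerivWithinAt) (α (κ n)).1 (α (κ n)).1
      have h2 := hasDerivWithinAt_quadratic (S := interior (Icc T (sq (κ n))))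
        (fun i j ↦ (hd i j).hasDerivWithinAt) (α (κ n)).2 (α (κ n)).2
      exact h1.add h2
    · intro x hx
      rw [interior_Icc] at hx
      refine (hball (α (κ n), x) ?_).le
      rw [Prod.dist_eq, max_lt_iff]
      refine ⟨hn1, ?_⟩
      rw [Real.dist_eq, abs_lt]
      constructor <;> linarith [hx.1, hx.2]
  have h1 : Φ (α (κ n), T) ≤ Φ (α (κ n), sq (κ n)) := hmono ⟨le_rfl, hTs₂⟩ ⟨hTs₂, le_rfl⟩ hTs₂
  have h2 : m ≤ Φ (α (κ n), T) := hatT (α (κ n)) (hαP (κ n))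
  have h3 : Φ (α (κ n), sq (κ n)) < m := hαlt (κ n)
  linarith

/-- **Hamilton 1997, Thm. B1.2 at the ODE level, in the form of the tree's chain of pinching
estimates**: relative to the constraint `{A, C symmetric}` (itself forward invariant,
`isInvariant_isSymm`), the set `{a₁ + a₂ ≥ m, c₁ + c₂ ≥ m}` (`m > 0`, Ky Fan form) is forward
invariant under Hamilton's ODE `M' = M² + M^#` ("This proves the theorem for `A`, and `C` is the
same": the `C`-equation is the `A`-equation for `(C, ᵗB)`, `field_snd_snd`).
[cite: Hamilton1997, §2.1, Thm. 1.2 (proof, p. 7)] -/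
theorem isInvariantRel_twoSmallestEigenvaluesSumGE {m : ℝ} (hm : 0 < m) :
    IsInvariantRel field (fun _ ↦ {p : Blocks | p.1.IsSymm ∧ p.2.2.IsSymm})
      (fun _ ↦ {p : Blocks | p.1.TwoSmallestEigenvaluesSumGE m ∧
        p.2.2.TwoSmallestEigenvaluesSumGE m}) := by
  intro γ t₀ t₁ _ h₁ hsol hK hin
  have ht₀ : t₀ ∈ Icc t₀ t₁ := left_mem_Icc.2 h₁
  have ht₁ : t₁ ∈ Icc t₀ t₁ := right_mem_Icc.2 h₁
  have hproj : ∀ s ∈ Icc t₀ t₁, (projIcc t₀ t₁ h₁ s : ℝ) = s := fun s hs ↦ by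
    rw [projIcc_of_mem h₁ hs]
  -- continuous extensions of the components beyond `[t₀, t₁]`
  set A : ℝ → Matrix (Fin 3) (Fin 3) ℝ := fun s ↦ (γ (projIcc t₀ t₁ h₁ s)).1 with hA
  set B : ℝ → Matrix (Fin 3) (Fin 3) ℝ := fun s ↦ (γ (projIcc t₀ t₁ h₁ s)).2.1 with hB
  set C : ℝ → Matrix (Fin 3) (Fin 3) ℝ := fun s ↦ (γ (projIcc t₀ t₁ h₁ s)).2.2 with hC
  have hcomp : ∀ f : ℝ → ℝ, (∀ s ∈ Icc t₀ t₁, ContinuousAt f s) →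
      Continuous fun s ↦ f (projIcc t₀ t₁ h₁ s) := by
    intro f hf
    have hco : ContinuousOn f (Icc t₀ t₁) := fun s hs ↦ (hf s hs).continuousWithinAt
    exact (continuousOn_iff_continuous_restrict.1 hco).comp continuous_projIcc
  have hAc : Continuous A := continuous_matrix fun i j ↦
    hcomp (fun s ↦ (γ s).1 i j) fun s hs ↦ ((hsol s hs).1 i j).continuousAt
  have hBc : Continuous B := continuous_matrix fun i j ↦
    hcomp (fun s ↦ (γ s).2.1 i j) fun s hs ↦ ((hsol s hs).2.1 i j).continuousAt
  have hCc : Continuous C := continuous_matrix fun i j ↦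
    hcomp (fun s ↦ (γ s).2.2 i j) fun s hs ↦ ((hsol s hs).2.2 i j).continuousAt
  have hBtc : Continuous fun s ↦ (B s)ᵀ := hBc.matrix_transpose
  -- the two blocks solve `X' = X² + Y ᵗY + 2X^#`
  have hAd : ∀ s ∈ Icc t₀ t₁, ∀ i j, HasDerivWithinAt (fun s ↦ A s i j)
      ((A s * A s + B s * (B s)ᵀ + (2 : ℝ) • (A s).sharp) i j) (Icc t₀ t₁) s := by
    intro s hs i j
    have h := ((hsol s hs).1 i j).hasDerivWithinAt (s := Icc t₀ t₁)
    refine (h.congr (fun s' hs' ↦ ?_) ?_).congr_deriv ?_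
    · show (γ (projIcc t₀ t₁ h₁ s')).1 i j = (γ s').1 i j
      rw [hproj s' hs']
    · show (γ (projIcc t₀ t₁ h₁ s)).1 i j = (γ s).1 i j
      rw [hproj s hs]
    · show (field (γ s)).1 i j = ((γ (projIcc t₀ t₁ h₁ s)).1 * (γ (projIcc t₀ t₁ h₁ s)).1 +
        (γ (projIcc t₀ t₁ h₁ s)).2.1 * ((γ (projIcc t₀ t₁ h₁ s)).2.1)ᵀ +
        (2 : ℝ) • ((γ (projIcc t₀ t₁ h₁ s)).1).sharp) i j
      rw [hproj s hs, field_fst]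
  have hCd : ∀ s ∈ Icc t₀ t₁, ∀ i j, HasDerivWithinAt (fun s ↦ C s i j)
      ((C s * C s + (B s)ᵀ * (B s)ᵀᵀ + (2 : ℝ) • (C s).sharp) i j) (Icc t₀ t₁) s := by
    intro s hs i j
    have h := ((hsol s hs).2.2 i j).hasDerivWithinAt (s := Icc t₀ t₁)
    refine (h.congr (fun s' hs' ↦ ?_) ?_).congr_deriv ?_
    · show (γ (projIcc t₀ t₁ h₁ s')).2.2 i j = (γ s').2.2 i j
      rw [hproj s' hs']
    · show (γ (projIcc t₀ t₁ h₁ s)).2.2 i j = (γ s).2.2 i j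
      rw [hproj s hs]
    · show (field (γ s)).2.2 i j = ((γ (projIcc t₀ t₁ h₁ s)).2.2 * (γ (projIcc t₀ t₁ h₁ s)).2.2 +
        ((γ (projIcc t₀ t₁ h₁ s)).2.1)ᵀ * ((γ (projIcc t₀ t₁ h₁ s)).2.1)ᵀᵀ +
        (2 : ℝ) • ((γ (projIcc t₀ t₁ h₁ s)).2.2).sharp) i j
      rw [hproj s hs, field_snd_snd]
  -- symmetry along the solution (the constraint), agreement at the endpoints
  have hAsymm : ∀ s ∈ Icc t₀ t₁, (A s).IsSymm := fun s hs ↦ by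
    show (γ (projIcc t₀ t₁ h₁ s)).1.IsSymm
    rw [hproj s hs]; exact (hK s hs).1
  have hCsymm : ∀ s ∈ Icc t₀ t₁, (C s).IsSymm := fun s hs ↦ by
    show (γ (projIcc t₀ t₁ h₁ s)).2.2.IsSymm
    rw [hproj s hs]; exact (hK s hs).2
  have hA0 : A t₀ = (γ t₀).1 := by
    show (γ (projIcc t₀ t₁ h₁ t₀)).1 = (γ t₀).1
    rw [hproj t₀ ht₀]
  have hC0 : C t₀ = (γ t₀).2.2 := by
    show (γ (projIcc t₀ t₁ h₁ t₀)).2.2 = (γ t₀).2.2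
    rw [hproj t₀ ht₀]
  have hA1 : A t₁ = (γ t₁).1 := by
    show (γ (projIcc t₀ t₁ h₁ t₁)).1 = (γ t₁).1
    rw [hproj t₁ ht₁]
  have hC1 : C t₁ = (γ t₁).2.2 := by
    show (γ (projIcc t₀ t₁ h₁ t₁)).2.2 = (γ t₁).2.2
    rw [hproj t₁ ht₁]
  have hAineq := twoSmallestEigenvaluesSumGE_of_hasDerivWithinAt hAc hBc hm hAd hAsymm
    (by rw [hA0]; exact hin.1)
  have hCineq := twoSmallestEigenvaluesSumGE_of_hasDerivWithinAt hCc hBtc hm hCd hCsymm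
    (by rw [hC0]; exact hin.2)
  show (γ t₁).1.TwoSmallestEigenvaluesSumGE m ∧ (γ t₁).2.2.TwoSmallestEigenvaluesSumGE m
  refine ⟨?_, ?_⟩
  · rw [← hA1]; exact hAineq t₁ ht₁
  · rw [← hC1]; exact hCineq t₁ ht₁

/-- **The invariant set fed to the maximum principle**: `{A, C symmetric, a₁ + a₂ ≥ m,
c₁ + c₂ ≥ m}`, `m > 0`, is forward invariant under Hamilton's ODE. [cite: Hamilton1997, §2.1, Thm. 1.2 (proof, p. 7)] -/
theorem isInvariant_isSymm_twoSmallestEigenvaluesSumGE {m : ℝ} (hm : 0 < m) :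
    IsInvariant field (fun _ ↦ {p : Blocks | p.1.IsSymm ∧ p.2.2.IsSymm} ∩
      {p : Blocks | p.1.TwoSmallestEigenvaluesSumGE m ∧ p.2.2.TwoSmallestEigenvaluesSumGE m}) :=
  isInvariant_isSymm.inter_rel_self (isInvariantRel_twoSmallestEigenvaluesSumGE hm)

end HamiltonODE

/-! ### Hamilton 1997, Thm. B1.2 for the Ricci flow, from the maximum principle for systems -/

open Lorentzian HamiltonODE

universe u

/-- **Hamilton 1997, §2.1, Thm. 1.2, second sentence ("For any constant `m > 0` the Ricci flow
preserves the inequalities `a₁ + a₂ ≥ m` and `c₁ + c₂ ≥ m`"), reduced to the maximum principle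
for systems** exactly as printed ("From the ordinary differential inequalities in [3] … The set
`a₁ + a₂ ≥ m` is convex …"): the named fact `ricciFlow_preserves_twoSmallestEigenvaluesSum_ge`
follows from `hamilton_maximumPrinciple_curvatureODE` (Hamilton 1986, Thm. 4.3 applied to the
curvature of the Ricci flow; `HamiltonCurvatureODE.lean`) applied to the closed convex
`B`-independent invariant set `{A, C symmetric, a₁ + a₂ ≥ m, c₁ + c₂ ≥ m}`, which contains the
blocks of `g(0)` in every orthonormal frame (the blocks of a Levi-Civita connection being
symmetric). [cite: Hamilton1997, §2.1, Thm. 1.2 (p. 7)] -/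
theorem ricciFlow_preserves_twoSmallestEigenvaluesSum_ge_of_maximumPrinciple
    (hMP : hamilton_maximumPrinciple_curvatureODE.{u}) :
    ricciFlow_preserves_twoSmallestEigenvaluesSum_ge.{u} := by
  intro M _ _ _ _ _ _ T g cov hflow hRiem m hm h0 t ht x e he u v hu hv huv
  have hT : 0 < T := ht.1.trans_lt ht.2
  have hLC : (g 0).IsLeviCivita (cov 0) := hflow.isLeviCivita 0 ⟨le_rfl, hT⟩
  have hn : (2 : ℕ∞ω) ≤ ∞ := WithTop.coe_le_coe.mpr le_top
  have hcl : IsClosed ({p : Blocks | p.1.IsSymm ∧ p.2.2.IsSymm} ∩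
      {p : Blocks | p.1.TwoSmallestEigenvaluesSumGE m ∧ p.2.2.TwoSmallestEigenvaluesSumGE m}) :=
    isClosed_isSymm.inter ((isClosed_twoSmallestA m).inter (isClosed_twoSmallestC m))
  have hZ := hMP M T g cov hflow hRiem (fun _ ↦ {p : Blocks | p.1.IsSymm ∧ p.2.2.IsSymm} ∩
      {p : Blocks | p.1.TwoSmallestEigenvaluesSumGE m ∧ p.2.2.TwoSmallestEigenvaluesSumGE m})
    (fun _ ↦ hcl)
    (fun _ ↦ by
      intro p hp q hq a b ha hb hab
      exact ⟨isSymm_combo hp.1 hq.1 a b, hp.2.1.combo hq.2.1 ha hb hab,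
        hp.2.2.combo hq.2.2 ha hb hab⟩)
    (isClosed_Ici.prod hcl) (fun _ p hp ↦ hp) (isInvariant_isSymm_twoSmallestEigenvaluesSumGE hm)
    (fun x e he ↦ ⟨⟨blockA_isSymm hLC hn x e, blockC_isSymm hLC hn x e⟩,
      fun u v hu hv huv ↦ (h0 x e he u v hu hv huv).1,
      fun u v hu hv huv ↦ (h0 x e he u v hu hv huv).2⟩) t ht x e he
  obtain ⟨-, hA', hC'⟩ := hZ
  exact ⟨hA' u v hu hv huv, hC' u v hu hv huv⟩

end Literature.Geometry.Riemannian

end
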